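import Summits.ResolutionOfSingularities.ResolutionOfSingularities.Theorems.PurelyInseparableDim4ResConeBInfFrames
import Summits.ResolutionOfSingularities.ResolutionOfSingularities.Theorems.PurelyInseparableDim4ResConeNear
import Summits.ResolutionOfSingularities.ResolutionOfSingularities.Theorems.PurelyInseparableDim4PhiLineFrameMoves
import Summits.ResolutionOfSingularities.ResolutionOfSingularities.Theorems.PurelyInseparableDim4PhiLineStepLawsTranslated
import Summits.ResolutionOfSingularities.ResolutionOfSingularities.Theorems.PurelyInseparableDim4PhiLineUFreePart
import Summits.ResolutionOfSingularities.ResolutionOfSingularities.Theorems.PurelyInseparableDim4PhiLineLabelTransport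
import Summits.ResolutionOfSingularities.ResolutionOfSingularities.Theorems.PurelyInseparableDim4PhiLineConeBridge
import Summits.ResolutionOfSingularities.ResolutionOfSingularities.Theorems.PurelyInseparableDim4PhiLineLoseLawChild
import Summits.ResolutionOfSingularities.ResolutionOfSingularities.Theorems.PurelyInseparableDim4PhiLineLabelVertex
import Summits.ResolutionOfSingularities.ResolutionOfSingularities.Theorems.PurelyInseparableDim4PhiLineDepartureLabel
import Literature.AlgebraicGeometry.Resolution.IsolationIndexed
import HarnessLib
import HarnessLib.Audit.Tags

/-!
# Purely inseparable four-folds — the B∞ LOSE STEP at `(p,d) = (5,3)` (STUB L of the holder's B∞ assembly skeleton)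
# (cell `res-dim4-pi`, K2(p) lane, slice C `(5,3)`, memo §17 (R4))

[OURS · counted 0 · cell `res-dim4-pi` · K2(p) lane holder res-dim4-p-12 g4 (HOLDER WORDs g4-2/g4-3, skeleton v2
`BInf-ASSEMBLY-SKELETON.lean` b10e0a76a4b9b1eb, «STUB L `stub_lose` = res-dim4-p-2 g5»); seat res-dim4-p-2 g5 over res-dim4-p-9 g4's
`…ResConeBInfFrames` (factorisations, twist / replace-row / arrival inverses), the holder's `…ThreeWeights` (`bInf_pattern`),
res-dim4-p-12 g2's `direction_mem_resVertex_of_shade_eq`, res-dim4-p-11 g4's Φ-line (IV/XII LOSE law, FrameMoves, (K-Φ1), X, XI,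
XIII, XIV) and this seat's (R3b) translated LOSE law.]  Nothing here proves K2(5), the β_h line or resolution of singularities in
dimension ≥ 4 / characteristic `p` — NOT proved.  AI kernel work, weaker than expert review.

**`bInf_lose_step`** = the skeleton's `stub_lose` with `EntryInv`/`RunInv` UNFOLDED: on TAIL-B data (isolated witnessed `Step0 5`
chain, `x^{r₀} ∣ F₀`, off the floor, shade `≡ 3` and `e_G ≡ 2` from `k₀`), at a Q-state `k ≥ k₀` (`|r_k| = 4`) carrying an
ENTRY-invariant frame `L` (left inverse `M`, `u₁ = e_h` with `r_k h = 2`, y-rows annihilating `resVertex (c k)`, `pts ≠ ∅`,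
`3! < δs`, `αs < 3!` for `(G_k)`), the child `c (k+1)` carries a RUN-invariant frame `L′` with critical letter the newborn `j k`
and `βs′ ≤ βs`.  Route: the Q-step hits `h` (`bInf_pattern`); TWIST `ũ₂ = u₂ − λu₁` so that every non-pivot row kills the
direction (`direction_mem_resVertex_of_shade_eq`; `twist_left_inverse`, `twist_binders`); LOSE law — chart `j k = h`:
`PhiLine.betaS_step_le_of_lose_of_child` (XII), chart `≠ h` (then `b k h ≠ 0`): `PhiLine.betaS_step_le_of_lose_translated_of_child`
(R3b) — with the child's `pts ≠ ∅`, `αs′ < 3!` from (K-Φ1) `PhiLine.alphaS_lt_of_isIsolated` (`r′_{j k} + 3 = 5`); departure label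
(XIV), VII transport, II residual, X re-adaptation (`0 < αs′ = δs − 3!`), XIII for the new y-rows.

[cite: CossartJannsenSaito2020, Lemma 12.1 (3), Lemma 13.4 (3), Lemma 13.6] [cite: CossartPiltant2008, Lemma 4.5 (2)] [cite: Hauser2010, §§F–G]
bears_on: LADDER-RESOLUTION:D157-DOOR2 (res-dim4-pi · K2(p) · slice C (5,3) B∞ · STUB L).  Supports stmt-ResolutionOfSingularities-16155 (helper).
-/

set_option linter.dupNamespace false -- mandated namespace of this single-conjunct summit

noncomputable section

namespace Summit.ResolutionOfSingularities.ResolutionOfSingularities.Theorems.PIDim4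


namespace ResCone

open MvPolynomial Finset IsLocalRing
open Literature.AlgebraicGeometry.Resolution
open Literature.AlgebraicGeometry.Resolution.CentreBlowup
open Literature.AlgebraicGeometry.Resolution.Hauser2010
open Literature.AlgebraicGeometry.Resolution.HauserPerlega2019
open Literature.AlgebraicGeometry.Resolution.WeightedOrder
open PointBlowup (direction additiveSubspace)

variable {K : Type} [Field K]

/-! ## 1. Small bookkeeping -/

/-- `e_h ⬝ w = w_h`. [folklore] -/
theorem sum_single_mul (h : Fin 4) (w : Fin 4 → K) : ∑ t, (Pi.single h (1 : K) : Fin 4 → K) t * w t = w h := by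
  rw [Finset.sum_eq_single h (fun t _ ht => by rw [Pi.single_eq_of_ne ht, zero_mul]) (fun hh => absurd (Finset.mem_univ h) hh),
    Pi.single_eq_same, one_mul]

/-- A left inverse in sum form is a matrix identity `M * L = 1`. [folklore] -/
theorem matrix_mul_eq_one_of_sum {L M : Matrix (Fin 4) (Fin 4) K}
    (hM : ∀ t u, ∑ i, M t i * L i u = if t = u then 1 else 0) : M * L = 1 := by
  ext t u
  rw [Matrix.mul_apply, Matrix.one_apply]
  exact hM t u

/-- … and conversely. [folklore] -/
theorem sum_of_matrix_mul_eq_one {L M : Matrix (Fin 4) (Fin 4) K} (hM : M * L = 1) :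
    ∀ t u, ∑ i, M t i * L i u = if t = u then 1 else 0 := by
  intro t u
  have h := congr_fun (congr_fun hM t) u
  rw [Matrix.mul_apply, Matrix.one_apply] at h
  exact h

section Lose

variable [CharP K 5] [DecidableEq K]

/-- **THE B∞ LOSE STEP (STUB L of the holder's skeleton, `EntryInv`/`RunInv` unfolded).**  See the module docstring. [OURS]
[cite: CossartJannsenSaito2020, Lemma 12.1 (3), Lemma 13.6] [cite: CossartPiltant2008, Lemma 4.5 (2)] -/
theorem bInf_lose_step {c : ℕ → State K} {j : ℕ → Fin 4} {b : ℕ → Fin 4 → K}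
    (hc : ∀ k, IsIsolated 5 (c k).F ∧ Step0 5 (c k) (c (k + 1))) (hw : FreeTail.IsWitnessedChain 5 c j b)
    (hr0 : ∀ e ∈ (c 0).F.support, (c 0).r ≤ e) (hfloor : ∀ k, ordZero (c k).F ≠ 5) {k₀ : ℕ}
    (hshade : ∀ k, k₀ ≤ k → (c k).shade = ((3 : ℕ) : ℕ∞))
    (he : ∀ k, k₀ ≤ k → Module.finrank K (resVertex (c k)) = 2)
    {k : ℕ} (hk : k₀ ≤ k) (h4 : (c k).r.degree = 4) {h : Fin 4} {L : Fin (2 + 2) → Fin 4 → K}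
    {M : Fin 4 → Fin (2 + 2) → K} (hM : ∀ t u, ∑ i, M t i * L i u = if t = u then 1 else 0)
    (hLu1 : L (u1 2) = Pi.single h 1)
    (hy : ∀ i, i ≠ u1 2 → i ≠ u2 2 → ∀ w ∈ resVertex (c k), ∑ t, L i t * w t = 0) (hrh : (c k).r h = 2)
    (hne : (pts (fun i => algebraMap (MvPolynomial (Fin 4) K) (OriginLocalization K 4) (∑ t, C (L i t) * X t))
      (Ideal.span {algebraMap (MvPolynomial (Fin 4) K) (OriginLocalization K 4) ((c k).F.divMonomial (c k).r)}) 3).Nonempty)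
    (hδ : Nat.factorial 3 < deltaS (fun i => algebraMap (MvPolynomial (Fin 4) K) (OriginLocalization K 4) (∑ t, C (L i t) * X t))
      (Ideal.span {algebraMap (MvPolynomial (Fin 4) K) (OriginLocalization K 4) ((c k).F.divMonomial (c k).r)}) 3) :
    ∃ (L' : Fin (2 + 2) → Fin 4 → K) (M' : Fin 4 → Fin (2 + 2) → K),
      ((∀ t u, ∑ i, M' t i * L' i u = if t = u then 1 else 0) ∧ L' (u1 2) = Pi.single (j k) 1 ∧
        (∀ i, i ≠ u1 2 → i ≠ u2 2 → ∀ w ∈ resVertex (c (k + 1)), ∑ t, L' i t * w t = 0) ∧ (c (k + 1)).r (j k) = 2 ∧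
        (pts (fun i => algebraMap (MvPolynomial (Fin 4) K) (OriginLocalization K 4) (∑ t, C (L' i t) * X t))
          (Ideal.span {algebraMap (MvPolynomial (Fin 4) K) (OriginLocalization K 4)
            ((c (k + 1)).F.divMonomial (c (k + 1)).r)}) 3).Nonempty ∧
        Nat.factorial 3 < deltaS (fun i => algebraMap (MvPolynomial (Fin 4) K) (OriginLocalization K 4) (∑ t, C (L' i t) * X t))
          (Ideal.span {algebraMap (MvPolynomial (Fin 4) K) (OriginLocalization K 4)
            ((c (k + 1)).F.divMonomial (c (k + 1)).r)}) 3 ∧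
        alphaS (fun i => algebraMap (MvPolynomial (Fin 4) K) (OriginLocalization K 4) (∑ t, C (L' i t) * X t))
          (Ideal.span {algebraMap (MvPolynomial (Fin 4) K) (OriginLocalization K 4)
            ((c (k + 1)).F.divMonomial (c (k + 1)).r)}) 3 < Nat.factorial 3) ∧
      0 < alphaS (fun i => algebraMap (MvPolynomial (Fin 4) K) (OriginLocalization K 4) (∑ t, C (L' i t) * X t))
          (Ideal.span {algebraMap (MvPolynomial (Fin 4) K) (OriginLocalization K 4)
            ((c (k + 1)).F.divMonomial (c (k + 1)).r)}) 3 ∧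
      betaS (fun i => algebraMap (MvPolynomial (Fin 4) K) (OriginLocalization K 4) (∑ t, C (L' i t) * X t))
          (Ideal.span {algebraMap (MvPolynomial (Fin 4) K) (OriginLocalization K 4)
            ((c (k + 1)).F.divMonomial (c (k + 1)).r)}) 3 ≤
        betaS (fun i => algebraMap (MvPolynomial (Fin 4) K) (OriginLocalization K 4) (∑ t, C (L i t) * X t))
          (Ideal.span {algebraMap (MvPolynomial (Fin 4) K) (OriginLocalization K 4) ((c k).F.divMonomial (c k).r)}) 3 := by
  classical
  haveI : Fact (Nat.Prime 5) := ⟨by norm_num⟩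
  set alg := algebraMap (MvPolynomial (Fin 4) K) (OriginLocalization K 4) with halg
  -- (0) the data of the step
  obtain ⟨hF, hd, hp, hdiv⟩ := bInf_factorisation hc hw hr0 hfloor hshade hk
  obtain ⟨hF', hd'⟩ := bInf_step_factorisation hc hw hr0 hfloor hshade hk
  obtain ⟨hF₁, hd₁, -, -⟩ := bInf_factorisation hc hw hr0 hfloor hshade (k := k + 1) (by omega)
  set G := (c k).F.divMonomial (c k).r with hG
  set G₁ := (c (k + 1)).F.divMonomial (c (k + 1)).r with hG₁
  have hstep : c (k + 1) = CentreBlowup.step 5 Finset.univ (j k) (b k) (c k) := (hw k).2.2.2.2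
  have hbj : b k (j k) = 0 := (hw k).2.1
  obtain ⟨-, hQ, -⟩ := bInf_pattern hc hw hr0 hfloor hshade hk hrh
  obtain ⟨hhit, hr'⟩ := hQ h4
  -- (1) the direction of the step lies in the vertex; the y-rows kill it
  have ho : ordZero (c k).F = ((7 : ℕ) : ℕ∞) := by
    rw [hF, PhiLine.ordZero_monomial_one_mul, hd, h4]; rfl
  have heq : (CentreBlowup.step 5 Finset.univ (j k) (b k) (c k)).shade = (c k).shade := by
    rw [← hstep, hshade (k + 1) (by omega), hshade k hk]
  have hdirV : direction (j k) (b k) ∈ resVertex (c k) :=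
    direction_mem_resVertex_of_shade_eq (j k) hbj ho hdiv (by norm_num) (by norm_num) heq
  have hdir : direction (j k) (b k) = Function.update (b k) (j k) 1 := rfl
  have hdirj : direction (j k) (b k) (j k) = 1 := by rw [hdir, Function.update_self]
  have hdirh : direction (j k) (b k) h ≠ 0 := by
    rcases hhit with hjh | hbh
    · rw [← hjh, hdirj]; exact one_ne_zero
    · have hjh : j k ≠ h := fun hh => hbh (by rw [← hh]; exact hbj)
      rw [hdir, Function.update_of_ne (Ne.symm hjh)]; exact hbh
  have hyk : ∀ i, i ≠ u1 2 → i ≠ u2 2 → ∑ t, L i t * direction (j k) (b k) t = 0 := fun i h1 h2 => hy i h1 h2 _ hdirV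
  -- (2) the twist `ũ₂ = u₂ − λ u₁`
  set lam : K := (∑ t, L (u2 2) t * direction (j k) (b k) t) * (direction (j k) (b k) h)⁻¹ with hlam
  set S : Fin (2 + 2) → Fin 4 → K := Function.update L (u2 2) (L (u2 2) - lam • L (u1 2)) with hS
  have hSq : S (u2 2) = L (u2 2) - lam • L (u1 2) := by rw [hS, Function.update_self]
  have hSi : ∀ i, i ≠ u2 2 → S i = L i := fun i hi => by rw [hS, Function.update_of_ne hi]
  have hSu1 : S (u1 2) = Pi.single h 1 := by rw [hSi _ u1_ne_u2, hLu1]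
  have hMS := twist_left_inverse hM u1_ne_u2 lam hSq hSi
  set MS : Fin 4 → Fin (2 + 2) → K := fun t i => M t i + if i = u1 2 then lam * M t (u2 2) else 0 with hMSdef
  have hMS' : ∀ t u, ∑ i, MS t i * S i u = if t = u then 1 else 0 := hMS
  have hkill : ∀ i, i ≠ u1 2 → ∑ t, S i t * direction (j k) (b k) t = 0 := by
    intro i hi
    by_cases hi2 : i = u2 2
    · subst hi2
      rw [hSq]
      simp only [Pi.sub_apply, Pi.smul_apply, smul_eq_mul, sub_mul, Finset.sum_sub_distrib, mul_assoc, ← Finset.mul_sum]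
      rw [hLu1, sum_single_mul, hlam, inv_mul_cancel_right₀ hdirh, sub_self]
    · rw [hSi i hi2]; exact hyk i hi hi2
  have hyS : ∀ i, i ≠ u1 2 → i ≠ u2 2 → ∀ w ∈ resVertex (c k), ∑ t, S i t * w t = 0 := fun i h1 h2 w hw' => by
    rw [hSi i h2]; exact hy i h1 h2 w hw'
  -- the polygon data in the twisted frame
  have hgenL := span_range_frame_eq_maximalIdeal L M hM
  have hgenS := span_range_frame_eq_maximalIdeal S MS hMS'
  have hdim := PhiLine.ringKrullDim_originLocalization_two_add_two (K := K)
  have hJμ : Ideal.span {alg G} ≤ maximalIdeal (OriginLocalization K 4) ^ 3 :=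
    PhiLine.span_singleton_algebraMap_le_maximalIdeal_pow hd.symm.le
  have hframeS := frameRow_twist (K := K) lam hSq hSi
  obtain ⟨hneS, hδS, hβS⟩ := PhiLine.twist_binders (fun i => alg (∑ t, C (L i t) * X t)) hgenL hdim (-alg (C lam)) hJμ hne hδ
  rw [← halg] at hframeS
  rw [← hframeS] at hneS hδS hβS
  -- (3) the common tail: from an arrival frame with the law's outputs to the run invariant
  have hBS := matrix_mul_eq_one_of_sum (L := S) (M := MS) hMS'
  have hSB := mul_eq_one_comm.mp hBS
  obtain ⟨Ψ, hΨ, hΨA, Q, hQmem, hGΨ⟩ :=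
    PhiLine.exists_label_of_yRows_annihilate 5 (by norm_num) hF hd hSB hBS (he k hk) hyS
  have hnear2 : ∀ i : Fin 2, ∑ t, S (Fin.castAdd 2 i) t * Function.update (b k) (j k) 1 t = 0 := fun i => by
    rw [← hdir]; exact hkill _ (castAdd_ne_u1 i)
  obtain ⟨Q', hH₀⟩ := PhiLine.chartTransform_translate_label hbj (fun i : Fin 2 => S (Fin.castAdd 2 i)) hnear2 hΨ hQmem hGΨ
    hd.symm.le
  obtain ⟨R, hres, hRmem⟩ := PhiLine.step_F_eq_monomial_mul_residual (p := 5) hF hd.symm.le hp (j k) hbj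
  rw [hF', monomial_one_mul_cancel_left_iff] at hres
  have hr'j : (((c k).r.filter fun i => b k i = 0).update (j k) ((c k).r.degree + 3 - 5)) (j k) = 2 := by
    rw [Finsupp.coe_update, Function.update_self, h4]
  have hR : R ∈ Ideal.span {(X (j k) : MvPolynomial (Fin 4) K) ^ 3} := by
    have := hRmem (j k) (by rw [hr'j]; decide)
    rwa [hr'j] at this
  have hε := PhiLine.constantCoeff_prod_ne_zero (b k) (fun i => (c k).r i)
  have hT := PhiLine.two_le_finrank_additiveSubspace_of_resVertex hF₁ hd₁ (he (k + 1) (by omega))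
  have hcrit₁ : 5 ≤ (c (k + 1)).r (j k) + 3 := by rw [hr']
  have tail : ∀ (L' : Fin (2 + 2) → Fin 4 → K) (M' : Fin 4 → Fin (2 + 2) → K),
      (∀ t u, ∑ i, M' t i * L' i u = if t = u then 1 else 0) → L' (u1 2) = Pi.single (j k) 1 →
      (∀ i, i ≠ u1 2 → L' i = Function.update (S i) (j k) 0) →
      alphaS (fun i => alg (∑ t, C (L' i t) * X t)) (Ideal.span {alg G₁}) 3 + Nat.factorial 3 =
        deltaS (fun i => alg (∑ t, C (S i t) * X t)) (Ideal.span {alg G}) 3 →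
      betaS (fun i => alg (∑ t, C (L' i t) * X t)) (Ideal.span {alg G₁}) 3 ≤
        betaS (fun i => alg (∑ t, C (S i t) * X t)) (Ideal.span {alg G}) 3 →
      ∃ (L'' : Fin (2 + 2) → Fin 4 → K) (M'' : Fin 4 → Fin (2 + 2) → K),
        ((∀ t u, ∑ i, M'' t i * L'' i u = if t = u then 1 else 0) ∧ L'' (u1 2) = Pi.single (j k) 1 ∧
          (∀ i, i ≠ u1 2 → i ≠ u2 2 → ∀ w ∈ resVertex (c (k + 1)), ∑ t, L'' i t * w t = 0) ∧ (c (k + 1)).r (j k) = 2 ∧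
          (pts (fun i => alg (∑ t, C (L'' i t) * X t)) (Ideal.span {alg G₁}) 3).Nonempty ∧
          Nat.factorial 3 < deltaS (fun i => alg (∑ t, C (L'' i t) * X t)) (Ideal.span {alg G₁}) 3 ∧
          alphaS (fun i => alg (∑ t, C (L'' i t) * X t)) (Ideal.span {alg G₁}) 3 < Nat.factorial 3) ∧
        0 < alphaS (fun i => alg (∑ t, C (L'' i t) * X t)) (Ideal.span {alg G₁}) 3 ∧
        betaS (fun i => alg (∑ t, C (L'' i t) * X t)) (Ideal.span {alg G₁}) 3 ≤
          betaS (fun i => alg (∑ t, C (L i t) * X t)) (Ideal.span {alg G}) 3 := by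
    intro L' M' hM' hL'u1 hL' hαeq hβle
    -- the child's polygon in the arrival frame: non-empty, `αs′ < 3!` ((K-Φ1)), hence `0 < αs′`
    have hgen' := span_range_frame_eq_maximalIdeal L' M' hM'
    have hu1' : (fun i => alg (∑ t, C (L' i t) * X t)) (u1 2) = alg (X (j k)) := by
      show alg (∑ t, C (L' (u1 2) t) * X t) = alg (X (j k))
      rw [hL'u1, halg, frameRow_single]
    obtain ⟨hne', hα'⟩ := PhiLine.alphaS_lt_of_isIsolated hF₁ (hc (k + 1)).1 hcrit₁ (fun i => alg (∑ t, C (L' i t) * X t))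
      hgen' hu1'
    have hα0 : 0 < alphaS (fun i => alg (∑ t, C (L' i t) * X t)) (Ideal.span {alg G₁}) 3 := by
      have := hδS; omega
    -- the re-adaptation (X) and the new y-rows (XIII)
    have hB'A := matrix_mul_eq_one_of_sum (L := L') (M := M') hM'
    have hAB' := mul_eq_one_comm.mp hB'A
    have hfun : (fun i : Fin 2 => ∑ t, C (Function.update (S (Fin.castAdd 2 i)) (j k) 0 t) * X t) =
        (fun i : Fin 2 => ∑ t, C (L' (Fin.castAdd 2 i) t) * X t) := by
      funext i
      rw [hL' _ (castAdd_ne_u1 i)]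
    have hH₀' : PointBlowup.translate (b k) (CentreBlowup.chartTransform 3 Finset.univ (j k) G) =
        aeval (fun i : Fin 2 => ∑ t, C (L' (Fin.castAdd 2 i) t) * X t) Ψ + X (j k) * Q' := by
      rw [hH₀, hfun]
    have hu12 : u1 2 ∈ ({u1 2, u2 2} : Finset (Fin (2 + 2))) := Finset.mem_insert_self _ _
    obtain ⟨lam', A', B', hA'B', hB'A', hrows, hA'u1, hA'u2, hne'', hδ'', hαeq'', hβeq''⟩ :=
      PhiLine.exists_label_readaptation_of_step 5 (d := 3) (by norm_num) hAB' hB'A hu12 hL'u1 hL'u1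
        (by norm_num) le_rfl hres hd' hε hR hH₀' hΨ hΨA hT hne' hα0 hα'
    have hy'' := PhiLine.yRows_annihilate_of_label 5 (by norm_num : 3 < 5) hF₁ hd₁ hA'B' hB'A' (he (k + 1) (by omega)) hδ''
    refine ⟨A', B', ⟨sum_of_matrix_mul_eq_one hB'A', by rw [hA'u1, hL'u1], hy'', hr', hne'', hδ'', by rw [hαeq'']; exact hα'⟩,
      by rw [hαeq'']; exact hα0, ?_⟩
    rw [hβeq'']
    exact hβle.trans hβS
  -- (4) the two charts
  rcases hhit with hjh | hbh
  · -- chart `h`: IV-lose from the child side (XII)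
    set L' : Fin (2 + 2) → Fin 4 → K := fun i => if i = u1 2 then Pi.single h 1 else Function.update (S i) h 0 with hL'def
    have hL'u1 : L' (u1 2) = Pi.single h 1 := by rw [hL'def]; exact if_pos rfl
    have hL' : ∀ i, i ≠ u1 2 → L' i = Function.update (S i) h 0 := fun i hi => by rw [hL'def]; exact if_neg hi
    have hM' := arrival_left_inverse hMS' hSu1 hL'u1 hL'
    have hbh : b k h = 0 := by rw [← hjh]; exact hbj
    have hnear : ∀ i, i ≠ u1 2 → ∑ t, S i t * Function.update (b k) h 1 t = 0 := fun i hi => by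
      rw [← hjh, ← hdir]; exact hkill i hi
    have hgen' := span_range_frame_eq_maximalIdeal L' _ hM'
    have hu1' : (fun i => alg (∑ t, C (L' i t) * X t)) (u1 2) = alg (X h) := by
      show alg (∑ t, C (L' (u1 2) t) * X t) = alg (X h)
      rw [hL'u1, halg, frameRow_single]
    obtain ⟨hne', hα'⟩ := PhiLine.alphaS_lt_of_isIsolated hF₁ (hc (k + 1)).1 (by rw [← hjh]; exact hcrit₁)
      (fun i => alg (∑ t, C (L' i t) * X t)) hgen' hu1'
    have hF'' : (CentreBlowup.step 5 Finset.univ h (b k) (c k)).F =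
        monomial (((c k).r.filter fun i => b k i = 0).update h ((c k).r.degree + 3 - 5)) 1 * G₁ := by
      rw [← hjh]; exact hF'
    obtain ⟨hαeq, hβle⟩ := PhiLine.betaS_step_le_of_lose_of_child hF hd hp hbh (by rw [h4]; decide) (by rw [h4])
      S L' MS _ hMS' hM' hSu1 hnear hL'u1 hL' hneS hδS hF'' hd' hne' hα'
    exact tail L' _ hM' (by rw [hL'u1, hjh]) (fun i hi => by rw [hL' i hi, hjh]) hαeq hβle
  · -- chart `j k ≠ h`, `b k h ≠ 0`: the translated law (R3b)
    have hjh : j k ≠ h := fun hh => hbh (by rw [← hh]; exact hbj)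
    -- replace the pivot row by `e_{j k}`, then drop the `j k`-coefficients
    set S₂ : Fin (2 + 2) → Fin 4 → K := Function.update S (u1 2) (Pi.single (j k) 1) with hS₂
    have hS₂u1 : S₂ (u1 2) = Pi.single (j k) 1 := by rw [hS₂, Function.update_self]
    have hS₂i : ∀ i, i ≠ u1 2 → S₂ i = S i := fun i hi => by rw [hS₂, Function.update_of_ne hi]
    have ha : ∑ t, (Pi.single (j k) (1 : K) : Fin 4 → K) t * MS t (u1 2) ≠ 0 :=
      coeff_replaceRow_ne_zero hMS' (piv := u1 2) (w := direction (j k) (b k)) hkill (by rw [sum_single_mul, hdirj]; exact one_ne_zero)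
    have hM₂ := replaceRow_left_inverse hMS' (u1 2) (Pi.single (j k) 1) ha hS₂u1 hS₂i
    set L' : Fin (2 + 2) → Fin 4 → K := fun i => if i = u1 2 then Pi.single (j k) 1 else Function.update (S i) (j k) 0
      with hL'def
    have hL'u1 : L' (u1 2) = Pi.single (j k) 1 := by rw [hL'def]; exact if_pos rfl
    have hL' : ∀ i, i ≠ u1 2 → L' i = Function.update (S i) (j k) 0 := fun i hi => by rw [hL'def]; exact if_neg hi
    have hL'₂ : ∀ i, i ≠ u1 2 → L' i = Function.update (S₂ i) (j k) 0 := fun i hi => by rw [hL' i hi, hS₂i i hi]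
    have hM' := arrival_left_inverse hM₂ hS₂u1 hL'u1 hL'₂
    have hnear : ∀ i, i ≠ u1 2 → ∑ t, S i t * Function.update (b k) (j k) 1 t = 0 := fun i hi => by
      rw [← hdir]; exact hkill i hi
    have hgen' := span_range_frame_eq_maximalIdeal L' _ hM'
    have hu1' : (fun i => alg (∑ t, C (L' i t) * X t)) (u1 2) = alg (X (j k)) := by
      show alg (∑ t, C (L' (u1 2) t) * X t) = alg (X (j k))
      rw [hL'u1, halg, frameRow_single]
    obtain ⟨hne', hα'⟩ := PhiLine.alphaS_lt_of_isIsolated hF₁ (hc (k + 1)).1 hcrit₁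
      (fun i => alg (∑ t, C (L' i t) * X t)) hgen' hu1'
    obtain ⟨hαeq, hβle⟩ := PhiLine.betaS_step_le_of_lose_translated_of_child hF hd hp hjh hbj hbh (by rw [h4]; decide)
      (by rw [h4]) S L' MS _ hMS' hM' hSu1 hnear hL'u1 hL' hneS hδS hF' hd' hne' hα'
    exact tail L' _ hM' hL'u1 hL' hαeq hβle

/-- **STUB L IN THE ASSEMBLY'S SHAPE**: the named hypothesis `hL` of res-dim4-p-9 g4's `no_bInf_tail_three_five_of_KL`
(`…ResConeBInfAssembly`, p703425) — skeleton v2's `stub_lose` with `EntryInv`/`RunInv` unfolded, per chain — discharged by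
`bInf_lose_step` (the parent's `αs < 3!` conjunct is not needed). [OURS] [cite: CossartJannsenSaito2020, Lemma 12.1 (3), Lemma 13.6] -/
theorem bInf_stub_lose {c : ℕ → State K} {j : ℕ → Fin 4} {b : ℕ → Fin 4 → K}
    (hc : ∀ k, IsIsolated 5 (c k).F ∧ Step0 5 (c k) (c (k + 1))) (hw : FreeTail.IsWitnessedChain 5 c j b)
    (hr0 : ∀ e ∈ (c 0).F.support, (c 0).r ≤ e) (hfloor : ∀ k, ordZero (c k).F ≠ 5) {k₀ : ℕ}
    (hshade : ∀ k, k₀ ≤ k → (c k).shade = ((3 : ℕ) : ℕ∞))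
    (he : ∀ k, k₀ ≤ k → Module.finrank K (resVertex (c k)) = 2) :
    ∀ k, k₀ ≤ k → (c k).r.degree = 4 → ∀ (h : Fin 4) (L : Fin (2 + 2) → Fin 4 → K) (M : Fin 4 → Fin (2 + 2) → K),
      ((∀ t u, ∑ i, M t i * L i u = if t = u then 1 else 0) ∧ L (u1 2) = Pi.single h 1 ∧
        (∀ i, i ≠ u1 2 → i ≠ u2 2 → ∀ w ∈ resVertex (c k), ∑ t, L i t * w t = 0) ∧ (c k).r h = 2 ∧
        (pts (fun i => algebraMap (MvPolynomial (Fin 4) K) (OriginLocalization K 4) (∑ t, C (L i t) * X t))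
          (Ideal.span {algebraMap (MvPolynomial (Fin 4) K) (OriginLocalization K 4)
            ((c k).F.divMonomial (c k).r)}) 3).Nonempty ∧
        Nat.factorial 3 < deltaS (fun i => algebraMap (MvPolynomial (Fin 4) K) (OriginLocalization K 4)
          (∑ t, C (L i t) * X t)) (Ideal.span {algebraMap (MvPolynomial (Fin 4) K) (OriginLocalization K 4)
            ((c k).F.divMonomial (c k).r)}) 3 ∧
        alphaS (fun i => algebraMap (MvPolynomial (Fin 4) K) (OriginLocalization K 4) (∑ t, C (L i t) * X t))
          (Ideal.span {algebraMap (MvPolynomial (Fin 4) K) (OriginLocalization K 4)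
            ((c k).F.divMonomial (c k).r)}) 3 < Nat.factorial 3) →
      ∃ (L' : Fin (2 + 2) → Fin 4 → K) (M' : Fin 4 → Fin (2 + 2) → K),
        (((∀ t u, ∑ i, M' t i * L' i u = if t = u then 1 else 0) ∧ L' (u1 2) = Pi.single (j k) 1 ∧
          (∀ i, i ≠ u1 2 → i ≠ u2 2 → ∀ w ∈ resVertex (c (k + 1)), ∑ t, L' i t * w t = 0) ∧ (c (k + 1)).r (j k) = 2 ∧
          (pts (fun i => algebraMap (MvPolynomial (Fin 4) K) (OriginLocalization K 4) (∑ t, C (L' i t) * X t))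
            (Ideal.span {algebraMap (MvPolynomial (Fin 4) K) (OriginLocalization K 4)
              ((c (k + 1)).F.divMonomial (c (k + 1)).r)}) 3).Nonempty ∧
          Nat.factorial 3 < deltaS (fun i => algebraMap (MvPolynomial (Fin 4) K) (OriginLocalization K 4)
            (∑ t, C (L' i t) * X t)) (Ideal.span {algebraMap (MvPolynomial (Fin 4) K) (OriginLocalization K 4)
              ((c (k + 1)).F.divMonomial (c (k + 1)).r)}) 3 ∧
          alphaS (fun i => algebraMap (MvPolynomial (Fin 4) K) (OriginLocalization K 4) (∑ t, C (L' i t) * X t))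
            (Ideal.span {algebraMap (MvPolynomial (Fin 4) K) (OriginLocalization K 4)
              ((c (k + 1)).F.divMonomial (c (k + 1)).r)}) 3 < Nat.factorial 3) ∧
        0 < alphaS (fun i => algebraMap (MvPolynomial (Fin 4) K) (OriginLocalization K 4) (∑ t, C (L' i t) * X t))
            (Ideal.span {algebraMap (MvPolynomial (Fin 4) K) (OriginLocalization K 4)
              ((c (k + 1)).F.divMonomial (c (k + 1)).r)}) 3) ∧
        betaS (fun i => algebraMap (MvPolynomial (Fin 4) K) (OriginLocalization K 4) (∑ t, C (L' i t) * X t))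
            (Ideal.span {algebraMap (MvPolynomial (Fin 4) K) (OriginLocalization K 4)
              ((c (k + 1)).F.divMonomial (c (k + 1)).r)}) 3 ≤
          betaS (fun i => algebraMap (MvPolynomial (Fin 4) K) (OriginLocalization K 4) (∑ t, C (L i t) * X t))
            (Ideal.span {algebraMap (MvPolynomial (Fin 4) K) (OriginLocalization K 4)
              ((c k).F.divMonomial (c k).r)}) 3 := by
  intro k hk h4 h L M hinv
  obtain ⟨hM, hLu1, hy, hrh, hne, hδ, -⟩ := hinv
  obtain ⟨L', M', h7, hpos, hle⟩ := bInf_lose_step hc hw hr0 hfloor hshade he hk h4 hM hLu1 hy hrh hne hδ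
  exact ⟨L', M', ⟨h7, hpos⟩, hle⟩

end Lose

end ResCone

end Summit.ResolutionOfSingularities.ResolutionOfSingularities.Theorems.PIDim4

end
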